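import Literature.Geometry.Kaehler.ComplexTorusKernelIdealRightOrder
import Literature.NumberTheory.Automorphic.BrandtXi
import HarnessLib

/-!
# Maximal orders of `End⁰(X)` are endomorphism rings of quotients `X/H(I)` (Kieffer 2024 §1.4.2, Prop. 1.4.8),
# with `η : End⁰(X/K) ≅ End⁰(X)` (Prop. 1.1.25) at torus level

For a complex torus `X = ComplexTorus Φ` (`Φ : (ι → ℝ) ≃L[ℝ] E`, `End(X) = endRingInt Φ ⊆ M_ι(ℤ)`,
`End⁰(X) = endAlgRat Φ ⊆ M_ι(ℚ)`), a finite subgroup `K ≤ X` with quotient `X/K` (`quotientByPeriod Φ K`, quotient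
isogeny `ρ(Q_K)`, `Q_K = quotientMatrix Φ K`) and Kieffer's `η = quotientEndHom Φ K : End(X/K) ↪ End⁰(X)`,
`γ ↦ Q_K⁻¹ γ Q_K` (`ComplexTorusKernelIdealRightOrder`), we formalize, at torus level:

> "**Proposition 1.1.25.** Let `φ : A → B` be an isogeny, and choose an integer `n ≥ 1` and an isogeny
> `ψ : B → A` such that `ψ ∘ φ = [n]_A` and `φ ∘ ψ = [n]_B` as in Proposition 1.1.13. Then the map
> `η : End⁰(B) → End⁰(A)`, `α ↦ (1/n) ψ ∘ α ∘ φ` is independent of the choices of `ψ` and `n` and is an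
> isomorphism of `ℚ`-algebras." [Kieffer2024IsogenyGraphs, p. 17]
>
> "If the endomorphism rings of the abelian varieties we consider are maximal orders in the endomorphism
> algebra, then the above construction of isogenies from ideals is particularly powerful.
> **Proposition 1.4.8.** Let `A` be an abelian variety over a finite field `k`, and let `S` be any maximal order
> in `End⁰(A)`. Then there exists another abelian variety `B` in the isogeny class of `A` whose endomorphism ring
> is isomorphic to `S`.
> *Proof.* Since `S` is a lattice in `End⁰(A)`, there exists an integer `N ≥ 1` such that `NS ⊂ End(A)`. Let
> `I = End(A)NS` be the ideal generated by `NS`. Then the right order of `I` contains `S`, so equals it. The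
> endomorphism ring of `A/H(I)` is `S` by Proposition 1.4.7." [Kieffer2024IsogenyGraphs, p. 46]

**Lean rendering.** "Maximal order in `End⁰(A)`" is the TREE's notion: a `ℤ`-order of the ring
`End⁰(X) = endAlgRat Φ` in the sense of `Literature.NumberTheory.Automorphic.Brandt.IsOrder` (a full `ℤ`-lattice —
`IsFullLattice`: finitely generated with `ℚ·O = End⁰(X)` — containing `1` and closed under multiplication; Voight
Def. 10.2.1) which is maximal, `Brandt.IsMaximalOrder (endAlgRat Φ) O` (Voight Def. 10.4.1); no new notion of order is
introduced.  `End(X)` itself is such an order (`endSubmodule`, `isOrder_endSubmodule`: it is finitely generated, and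
every rational endomorphism has an integral multiple in `End(X)` — "`S` is a lattice in `End⁰(A)`, [so] there exists
an integer `N ≥ 1` such that `NS ⊂ End(A)`" is the tree's `exists_smul_mem_of_fg`), and so is `η(End(X/K))` for every
finite `K ≤ X` (`etaSubmodule`, `isOrder_etaSubmodule`: `det Q_K · η(γ) = adj(Q_K) γ Q_K ∈ End(X)` and
`det Q_K · α = η(Q_K α adj(Q_K))`).  The printed proof is then followed: `I = End(X)NS` (`idealOfOrder`),
`N = N·1 ∈ I` is an isogeny so `H(I)` is finite, and "the right order of `I` contains `S`" (`mem_rightOrder_idealOfOrder`,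
`(Ns′)s = N(s′s)`).  For the last sentence we use, instead of Prop. 1.4.7 (which needs `I` to be a kernel ideal), its
inclusion `O_r(I) ⊆ η(End(X/H(I)))` valid for EVERY `I` (`rightOrder_le_range_quotientEndHom` of
`ComplexTorusKernelIdealRightOrder`) together with the maximality of `S` among orders: `η(End(X/H(I))) = S = O_r(I)`.
The finite base field of the printed statement plays no role: the argument is one about lattices in `End⁰`, valid for
every complex torus.  §1 records Prop. 1.1.25 for the quotient isogenies `X → X/K`: conjugation by `Q_K` is a
`ℚ`-algebra isomorphism `End⁰(X/K) ≅ End⁰(X)` extending `η`.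

## Contents (namespace `Literature.Geometry.Kaehler.ComplexTorus`)

* §1 PROP. 1.1.25: `conj_mem_endAlgRat_iff` (`Q⁻¹ M Q ∈ End⁰(X) ⟺ M ∈ End⁰(X/K)`), **`quotientEndAlgEquiv Φ K :
  endAlgRat (X/K) ≃ₐ[ℚ] endAlgRat X`** (`M ↦ Q_K⁻¹ M Q_K`), `coe_quotientEndAlgEquiv`, `coe_quotientEndAlgEquiv_symm`,
  `quotientEndAlgEquiv_coe` (it extends `η = quotientEndHom`).
* §2 Orders: `endToEndAlgRat` (`End(X) ↪ End⁰(X)`), **`endSubmodule Φ`** (`End(X) ⊆ End⁰(X)` as a `ℤ`-submodule),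
  `exists_intMatrix_map_eq_zsmul` (clearing denominators), `isFullLattice_endSubmodule`, **`isOrder_endSubmodule`**
  (`End(X)` is a `ℤ`-order of `End⁰(X)`), `quotientEndToEndAlgRat`, **`etaSubmodule Φ K = η(End(X/K))`**,
  `exists_coe_eq_det_smul_quotientEndHom` (`det Q_K · η(γ) ∈ End(X)`), `det_smul_coe_mem_range_quotientEndHom`
  (`det Q_K · α ∈ η(End(X/K))`), `isFullLattice_etaSubmodule`, **`isOrder_etaSubmodule`** (`η(End(X/K))` is an order),
  `exists_smul_mem_endSubmodule` ("`NS ⊂ End(A)` for some `N ≥ 1`", from the tree's `exists_smul_mem_of_fg`).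
* §3 PROP. 1.4.8: `idealOfOrder Φ O N = End(X)·NO`, `mem_idealOfOrder_of_coe_eq`, `exists_mem_idealOfOrder_det_ne_zero`
  (`N·1 ∈ I` is an isogeny), `finite_kernelSubgroup_idealOfOrder`, **`mem_rightOrder_idealOfOrder`** ("the right
  order of `I` contains `S`"), `etaSubmodule_le_of_forall_mem_rightOrder`, **`IsMaximalOrder.etaSubmodule_eq`**
  (`η(End(X/H(I))) = S`), `IsMaximalOrder.mem_rightOrder_idealOfOrder_iff` ("so equals it"),
  `IsMaximalOrder.mem_range_quotientEndHom_iff`, **`IsMaximalOrder.exists_quotient`** (∃ finite `K ≤ X`, `X/K`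
  isogenous to `X`, `η(End(X/K)) = S`, with `End(X/K) ≃+* η(End(X/K))`).

No named facts are introduced (definitions with bodies and proved theorems only).

## References

* [Kieffer2024IsogenyGraphs] J. Kieffer, *Isogeny graphs in higher dimensions* (lecture notes, 2024), §1.1.5
  Prop. 1.1.25 (p. 17); §1.4.2 Prop. 1.4.8 with proof (p. 46); after W. C. Waterhouse, *Abelian varieties over
  finite fields*, Ann. Sci. ÉNS (4) 2 (1969), §3 (Thm. 3.13).
* [Lange2023AbelianVarietiesComplex] H. Lange, *Abelian Varieties over the Complex Numbers*, Springer 2023, §1.1.2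
  (analytic and rational representations; Prop. 1.1.8 and p. 22: `End_ℚ(X) = End(X) ⊗ ℚ`).
* [Voight2021] J. Voight, *Quaternion Algebras*, GTM 288, Springer 2021, Def. 10.2.1 (`R`-orders), Def. 10.4.1 (maximal
  orders) — the tree's `Brandt.IsOrder` / `Brandt.IsMaximalOrder`.
-/

noncomputable section

open Module Function
open scoped Matrix

namespace Literature.Geometry.Kaehler

namespace ComplexTorus

variable {ι : Type*} [Fintype ι] [DecidableEq ι] {E : Type*} [NormedAddCommGroup E] [NormedSpace ℂ E]
  (Φ : (ι → ℝ) ≃L[ℝ] E)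

/-! ## Casts (plumbing) -/

omit [Fintype ι] [DecidableEq ι] in
/-- `ℤ → ℚ → ℝ` casts of an integer matrix. [folklore] -/
private theorem map_intCast_map_ratCast (A : Matrix ι ι ℤ) :
    (A.map (Int.cast : ℤ → ℚ)).map (Rat.cast : ℚ → ℝ) = A.map (Int.cast : ℤ → ℝ) :=
  Matrix.ext fun i j ↦ Rat.cast_intCast (A i j)

omit [DecidableEq ι] in
/-- Entrywise cast `ℚ → ℝ` of a product. [folklore] -/
private theorem map_ratCast_mul (A B : Matrix ι ι ℚ) :
    (A * B).map (Rat.cast : ℚ → ℝ) = A.map (Rat.cast : ℚ → ℝ) * B.map (Rat.cast : ℚ → ℝ) :=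
  Matrix.map_mul (f := Rat.castHom ℝ)

omit [DecidableEq ι] in
/-- Entrywise cast `ℤ → ℚ` of a product. [folklore] -/
private theorem map_intCast_mul_rat (A B : Matrix ι ι ℤ) :
    (A * B).map (Int.cast : ℤ → ℚ) = A.map (Int.cast : ℤ → ℚ) * B.map (Int.cast : ℤ → ℚ) :=
  Matrix.map_mul (f := Int.castRingHom ℚ)

/-- Entrywise cast `ℚ → ℝ` of the inverse of an invertible rational matrix. [folklore] -/
private theorem map_ratCast_inv {g : Matrix ι ι ℚ} (hg : IsUnit g.det) :
    (g⁻¹).map (Rat.cast : ℚ → ℝ) = (g.map (Rat.cast : ℚ → ℝ))⁻¹ :=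
  (Matrix.inv_eq_right_inv (by
    rw [← map_ratCast_mul, Matrix.mul_nonsing_inv _ hg, Matrix.map_one Rat.cast Rat.cast_zero Rat.cast_one])).symm

/-- `det A • A⁻¹ = adj A` for an invertible matrix. [folklore] -/
private theorem det_smul_nonsing_inv {R : Type*} [CommRing R] {A : Matrix ι ι R} (hA : IsUnit A.det) :
    A.det • A⁻¹ = A.adjugate := by
  calc A.det • A⁻¹ = A⁻¹ * (A.det • (1 : Matrix ι ι R)) := by rw [Matrix.mul_smul, Matrix.mul_one]
    _ = A⁻¹ * (A * A.adjugate) := by rw [Matrix.mul_adjugate]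
    _ = A.adjugate := Matrix.nonsing_inv_mul_cancel_left A _ hA

/-- The adjugate commutes with `ℤ → ℚ`. [folklore] -/
private theorem adjugate_map_intCast (A : Matrix ι ι ℤ) :
    (A.map (Int.cast : ℤ → ℚ)).adjugate = A.adjugate.map (Int.cast : ℤ → ℚ) := by
  have h := RingHom.map_adjugate (Int.castRingHom ℚ) A
  rw [RingHom.mapMatrix_apply, RingHom.mapMatrix_apply] at h
  exact h.symm

/-! ## §1 Prop. 1.1.25 for `X → X/K`: conjugation by `Q_K` is `End⁰(X/K) ≅ End⁰(X)`, extending `η` -/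

section EndAlgEquiv

variable (K : AddSubgroup (ComplexTorus Φ)) [Finite K]

/-- `J_{X/K} = Q J_X Q⁻¹` in real matrices: `J' = Q J Q⁻¹` and `J = Q⁻¹ J' Q`. [cite: Lange2023AbelianVarietiesComplex, §1.1.2 (analytic and rational representations)] -/
private theorem jMatrix_quotientBy_eq :
    jMatrix (quotientByPeriod Φ K) = (quotientMatrix Φ K).map (Int.cast : ℤ → ℝ) * jMatrix Φ *
      ((quotientMatrix Φ K).map (Int.cast : ℤ → ℝ))⁻¹ := by
  have hu : IsUnit ((quotientMatrix Φ K).map (Int.cast : ℤ → ℝ)).det :=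
    isUnit_det_map_intCast _ (det_quotientMatrix_ne_zero Φ K)
  have hJQ : jMatrix (quotientByPeriod Φ K) * (quotientMatrix Φ K).map (Int.cast : ℤ → ℝ) =
      (quotientMatrix Φ K).map (Int.cast : ℤ → ℝ) * jMatrix Φ :=
    jMatrix_quotientPeriod_mul Φ (quotientMatrix Φ K) (det_quotientMatrix_ne_zero Φ K)
  rw [← hJQ, Matrix.mul_nonsing_inv_cancel_right _ _ hu]

/-- **`Q⁻¹ M Q ∈ End⁰(X) ⟺ M ∈ End⁰(X/K)`** for a rational matrix `M` (`J_{X/K} = Q J_X Q⁻¹`).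
[cite: Kieffer2024IsogenyGraphs, §1.1.5 Prop. 1.1.25, p. 17] -/
theorem conj_mem_endAlgRat_iff (M : Matrix ι ι ℚ) :
    (quotientMatrixRat Φ K)⁻¹ * M * quotientMatrixRat Φ K ∈ endAlgRat Φ ↔ M ∈ endAlgRat (quotientByPeriod Φ K) := by
  have huq : IsUnit (quotientMatrixRat Φ K).det := isUnit_det_quotientMatrixRat Φ K
  have hu : IsUnit ((quotientMatrix Φ K).map (Int.cast : ℤ → ℝ)).det :=
    isUnit_det_map_intCast _ (det_quotientMatrix_ne_zero Φ K)
  have hQr : (quotientMatrixRat Φ K).map (Rat.cast : ℚ → ℝ) = (quotientMatrix Φ K).map (Int.cast : ℤ → ℝ) :=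
    map_intCast_map_ratCast _
  have hQir : ((quotientMatrixRat Φ K)⁻¹).map (Rat.cast : ℚ → ℝ) = ((quotientMatrix Φ K).map (Int.cast : ℤ → ℝ))⁻¹ := by
    rw [map_ratCast_inv huq, hQr]
  rw [mem_endAlgRat_iff, mem_endAlgRat_iff, map_ratCast_mul, map_ratCast_mul, hQr, hQir, jMatrix_quotientBy_eq]
  set Q := (quotientMatrix Φ K).map (Int.cast : ℤ → ℝ)
  set J := jMatrix Φ
  set Mr := M.map (Rat.cast : ℚ → ℝ)
  constructor
  · intro h
    -- `Mr (Q J Q⁻¹) = Q (Q⁻¹ Mr Q J) Q⁻¹ = Q (J Q⁻¹ Mr Q) Q⁻¹ = (Q J Q⁻¹) Mr`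
    calc Mr * (Q * J * Q⁻¹) = Q * (Q⁻¹ * Mr * Q * J) * Q⁻¹ := by
          rw [show Q * (Q⁻¹ * Mr * Q * J) * Q⁻¹ = Q * (Q⁻¹ * (Mr * (Q * J * Q⁻¹))) by
            simp only [Matrix.mul_assoc], Matrix.mul_nonsing_inv_cancel_left _ _ hu]
      _ = Q * (J * (Q⁻¹ * Mr * Q)) * Q⁻¹ := by rw [h]
      _ = Q * J * Q⁻¹ * Mr := by
          rw [show Q * (J * (Q⁻¹ * Mr * Q)) * Q⁻¹ = Q * J * Q⁻¹ * (Mr * (Q * Q⁻¹)) by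
            simp only [Matrix.mul_assoc], Matrix.mul_nonsing_inv _ hu, Matrix.mul_one]
  · intro h
    -- `Q⁻¹ Mr Q J = Q⁻¹ Mr (Q J Q⁻¹) Q = Q⁻¹ (Q J Q⁻¹) Mr Q = J Q⁻¹ Mr Q`
    calc Q⁻¹ * Mr * Q * J = Q⁻¹ * (Mr * (Q * J * Q⁻¹)) * Q := by
          rw [show Q⁻¹ * (Mr * (Q * J * Q⁻¹)) * Q = Q⁻¹ * Mr * Q * J * (Q⁻¹ * Q) by
            simp only [Matrix.mul_assoc], Matrix.nonsing_inv_mul _ hu, Matrix.mul_one]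
      _ = Q⁻¹ * (Q * J * Q⁻¹ * Mr) * Q := by rw [h]
      _ = J * (Q⁻¹ * Mr * Q) := by
          rw [show Q⁻¹ * (Q * J * Q⁻¹ * Mr) * Q = Q⁻¹ * (Q * (J * (Q⁻¹ * Mr * Q))) by
            simp only [Matrix.mul_assoc], Matrix.nonsing_inv_mul_cancel_left _ _ hu]

/-- **PROPOSITION 1.1.25 at torus level, for the quotient isogeny `φ_K : X → X/K`: conjugation by the rational
representation `Q_K`, `M ↦ Q_K⁻¹ M Q_K`, is an isomorphism of `ℚ`-algebras `End⁰(X/K) ≅ End⁰(X)`** (with inverse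
`M ↦ Q_K M Q_K⁻¹`; on `End(X/K)` it is Kieffer's `η = (1/n) ψ ∘ α ∘ φ`, `quotientEndAlgEquiv_coe`).
[cite: Kieffer2024IsogenyGraphs, §1.1.5 Prop. 1.1.25, p. 17] -/
def quotientEndAlgEquiv : endAlgRat (quotientByPeriod Φ K) ≃ₐ[ℚ] endAlgRat Φ where
  toFun M := ⟨(quotientMatrixRat Φ K)⁻¹ * (M : Matrix ι ι ℚ) * quotientMatrixRat Φ K,
    (conj_mem_endAlgRat_iff Φ K _).2 M.2⟩
  invFun M := ⟨quotientMatrixRat Φ K * (M : Matrix ι ι ℚ) * (quotientMatrixRat Φ K)⁻¹,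
    (conj_mem_endAlgRat_iff Φ K _).1 (by
      rw [show (quotientMatrixRat Φ K)⁻¹ * (quotientMatrixRat Φ K * (M : Matrix ι ι ℚ) * (quotientMatrixRat Φ K)⁻¹) *
          quotientMatrixRat Φ K = (quotientMatrixRat Φ K)⁻¹ * (quotientMatrixRat Φ K * ((M : Matrix ι ι ℚ) *
          ((quotientMatrixRat Φ K)⁻¹ * quotientMatrixRat Φ K))) by simp only [Matrix.mul_assoc],
        Matrix.nonsing_inv_mul _ (isUnit_det_quotientMatrixRat Φ K), Matrix.mul_one,
        Matrix.nonsing_inv_mul_cancel_left _ _ (isUnit_det_quotientMatrixRat Φ K)]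
      exact M.2)⟩
  left_inv M := Subtype.ext (by
    change quotientMatrixRat Φ K * ((quotientMatrixRat Φ K)⁻¹ * (M : Matrix ι ι ℚ) * quotientMatrixRat Φ K) *
      (quotientMatrixRat Φ K)⁻¹ = (M : Matrix ι ι ℚ)
    rw [show quotientMatrixRat Φ K * ((quotientMatrixRat Φ K)⁻¹ * (M : Matrix ι ι ℚ) * quotientMatrixRat Φ K) *
        (quotientMatrixRat Φ K)⁻¹ = quotientMatrixRat Φ K * ((quotientMatrixRat Φ K)⁻¹ * ((M : Matrix ι ι ℚ) *
        (quotientMatrixRat Φ K * (quotientMatrixRat Φ K)⁻¹))) by simp only [Matrix.mul_assoc],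
      Matrix.mul_nonsing_inv _ (isUnit_det_quotientMatrixRat Φ K), Matrix.mul_one,
      Matrix.mul_nonsing_inv_cancel_left _ _ (isUnit_det_quotientMatrixRat Φ K)])
  right_inv M := Subtype.ext (by
    change (quotientMatrixRat Φ K)⁻¹ * (quotientMatrixRat Φ K * (M : Matrix ι ι ℚ) * (quotientMatrixRat Φ K)⁻¹) *
      quotientMatrixRat Φ K = (M : Matrix ι ι ℚ)
    rw [show (quotientMatrixRat Φ K)⁻¹ * (quotientMatrixRat Φ K * (M : Matrix ι ι ℚ) * (quotientMatrixRat Φ K)⁻¹) *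
        quotientMatrixRat Φ K = (quotientMatrixRat Φ K)⁻¹ * (quotientMatrixRat Φ K * ((M : Matrix ι ι ℚ) *
        ((quotientMatrixRat Φ K)⁻¹ * quotientMatrixRat Φ K))) by simp only [Matrix.mul_assoc],
      Matrix.nonsing_inv_mul _ (isUnit_det_quotientMatrixRat Φ K), Matrix.mul_one,
      Matrix.nonsing_inv_mul_cancel_left _ _ (isUnit_det_quotientMatrixRat Φ K)])
  map_mul' M N := Subtype.ext (by
    change (quotientMatrixRat Φ K)⁻¹ * ((M : Matrix ι ι ℚ) * (N : Matrix ι ι ℚ)) * quotientMatrixRat Φ K =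
      (quotientMatrixRat Φ K)⁻¹ * (M : Matrix ι ι ℚ) * quotientMatrixRat Φ K *
        ((quotientMatrixRat Φ K)⁻¹ * (N : Matrix ι ι ℚ) * quotientMatrixRat Φ K)
    rw [show (quotientMatrixRat Φ K)⁻¹ * (M : Matrix ι ι ℚ) * quotientMatrixRat Φ K *
        ((quotientMatrixRat Φ K)⁻¹ * (N : Matrix ι ι ℚ) * quotientMatrixRat Φ K) =
        (quotientMatrixRat Φ K)⁻¹ * (M : Matrix ι ι ℚ) * (quotientMatrixRat Φ K *
        ((quotientMatrixRat Φ K)⁻¹ * ((N : Matrix ι ι ℚ) * quotientMatrixRat Φ K))) by simp only [Matrix.mul_assoc],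
      Matrix.mul_nonsing_inv_cancel_left _ _ (isUnit_det_quotientMatrixRat Φ K)]
    simp only [Matrix.mul_assoc])
  map_add' M N := Subtype.ext (by
    change (quotientMatrixRat Φ K)⁻¹ * ((M : Matrix ι ι ℚ) + (N : Matrix ι ι ℚ)) * quotientMatrixRat Φ K =
      (quotientMatrixRat Φ K)⁻¹ * (M : Matrix ι ι ℚ) * quotientMatrixRat Φ K +
        (quotientMatrixRat Φ K)⁻¹ * (N : Matrix ι ι ℚ) * quotientMatrixRat Φ K
    rw [Matrix.mul_add, Matrix.add_mul])
  commutes' r := Subtype.ext (by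
    change (quotientMatrixRat Φ K)⁻¹ * (algebraMap ℚ (Matrix ι ι ℚ) r) * quotientMatrixRat Φ K =
      algebraMap ℚ (Matrix ι ι ℚ) r
    rw [Algebra.algebraMap_eq_smul_one, Matrix.mul_smul, Matrix.mul_one, Matrix.smul_mul,
      Matrix.nonsing_inv_mul _ (isUnit_det_quotientMatrixRat Φ K)])

/-- `quotientEndAlgEquiv` on matrices: `M ↦ Q⁻¹ M Q`. [cite: Kieffer2024IsogenyGraphs, §1.1.5 Prop. 1.1.25, p. 17] -/
@[simp] theorem coe_quotientEndAlgEquiv (M : endAlgRat (quotientByPeriod Φ K)) :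
    (quotientEndAlgEquiv Φ K M : Matrix ι ι ℚ) = (quotientMatrixRat Φ K)⁻¹ * (M : Matrix ι ι ℚ) * quotientMatrixRat Φ K :=
  rfl

/-- The inverse on matrices: `M ↦ Q M Q⁻¹` ("its inverse is `β ↦ (1/n) φ ∘ β ∘ ψ`").
[cite: Kieffer2024IsogenyGraphs, §1.1.5 Prop. 1.1.25 (proof), p. 17] -/
@[simp] theorem coe_quotientEndAlgEquiv_symm (M : endAlgRat Φ) :
    ((quotientEndAlgEquiv Φ K).symm M : Matrix ι ι ℚ) =
      quotientMatrixRat Φ K * (M : Matrix ι ι ℚ) * (quotientMatrixRat Φ K)⁻¹ :=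
  rfl

/-- **`quotientEndAlgEquiv` extends `η`**: on an integral `γ ∈ End(X/K)` it is `quotientEndHom Φ K γ`.
[cite: Kieffer2024IsogenyGraphs, §1.1.5 Prop. 1.1.25 and §1.4.1 (the map `η`), pp. 17, 44] -/
theorem quotientEndAlgEquiv_coe (γ : endRingInt (quotientByPeriod Φ K)) :
    (quotientEndAlgEquiv Φ K ⟨(γ : Matrix ι ι ℤ).map (Int.cast : ℤ → ℚ),
        (mem_endRingInt_iff (quotientByPeriod Φ K)).1 γ.2⟩ : Matrix ι ι ℚ) = quotientEndHom Φ K γ :=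
  rfl

end EndAlgEquiv

/-! ## §2 `End(X)` and `η(End(X/K))` are `ℤ`-orders of `End⁰(X)` -/

section Orders

open Literature.NumberTheory.Automorphic

/-- **`End(X) ↪ End⁰(X) = End(X) ⊗ ℚ`**, `α ↦ α ⊗ 1` (the inclusion `M_ι(ℤ) ⊆ M_ι(ℚ)` restricted to `End(X)`).
[cite: Lange2023AbelianVarietiesComplex, §1.1.2 (p. 22: "`Hom(X, X′)` can and will be considered as a subgroup of `Hom_ℚ(X, X′)`")] -/
def endToEndAlgRat : endRingInt Φ →+* endAlgRat Φ :=
  (((Int.castRingHom ℚ).mapMatrix).comp (endRingInt Φ).subtype).codRestrict (endAlgRat Φ)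
    fun α ↦ (mem_endRingInt_iff Φ).1 α.2

/-- On matrices `endToEndAlgRat` is the entrywise cast. [cite: Lange2023AbelianVarietiesComplex, §1.1.2, p. 22] -/
@[simp] theorem coe_endToEndAlgRat (α : endRingInt Φ) :
    (endToEndAlgRat Φ α : Matrix ι ι ℚ) = (α : Matrix ι ι ℤ).map (Int.cast : ℤ → ℚ) :=
  rfl

/-- `End(X) → End⁰(X)` is injective. [cite: Lange2023AbelianVarietiesComplex, §1.1.2 Prop. 1.1.8, p. 22] -/
theorem endToEndAlgRat_injective : Injective (endToEndAlgRat Φ) := fun _ _ h ↦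
  Subtype.ext (Matrix.map_injective (Int.cast_injective (α := ℚ)) (congrArg Subtype.val h))

/-- **`End(X) ⊆ End⁰(X)` as a `ℤ`-submodule** (the lattice with respect to which orders of `End⁰(X)` are measured).
[cite: Kieffer2024IsogenyGraphs, §1.4.2 Prop. 1.4.8 (proof: "`NS ⊂ End(A)`"), p. 46] -/
def endSubmodule : Submodule ℤ (endAlgRat Φ) :=
  LinearMap.range (endToEndAlgRat Φ).toAddMonoidHom.toIntLinearMap

/-- Membership in `endSubmodule`: being the image of an integral endomorphism.
[cite: Kieffer2024IsogenyGraphs, §1.4.2 Prop. 1.4.8 (proof), p. 46] -/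
theorem mem_endSubmodule_iff {M : endAlgRat Φ} :
    M ∈ endSubmodule Φ ↔ ∃ α : endRingInt Φ, (α : Matrix ι ι ℤ).map (Int.cast : ℤ → ℚ) = (M : Matrix ι ι ℚ) := by
  constructor
  · rintro ⟨α, hα⟩
    exact ⟨α, by rw [← hα]; rfl⟩
  · rintro ⟨α, hα⟩
    exact ⟨α, Subtype.ext hα⟩

/-- Coercion of an integer multiple in `End⁰(X)`: `↑(n • M) = n • ↑M`. [folklore] -/
private theorem coe_zsmul_endAlgRat (n : ℤ) (M : endAlgRat Φ) :
    ((n • M : endAlgRat Φ) : Matrix ι ι ℚ) = (n : ℚ) • (M : Matrix ι ι ℚ) := by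
  rw [Int.cast_smul_eq_zsmul]
  rfl

omit [DecidableEq ι] in
/-- **Clearing denominators**: a rational matrix is `d⁻¹ A` for an integer `d ≠ 0` and an integer matrix `A`
(a private copy of the tree's `exists_intMatrix_map_eq_smul`). [folklore] -/
private theorem exists_intMatrix_map_eq_zsmul (B : Matrix ι ι ℚ) :
    ∃ d : ℤ, d ≠ 0 ∧ ∃ A : Matrix ι ι ℤ, A.map (Int.cast : ℤ → ℚ) = d • B := by
  obtain ⟨⟨d, hd⟩, h⟩ :=
    IsLocalization.exist_integer_multiples_of_finite (nonZeroDivisors ℤ) fun p : ι × ι ↦ B p.1 p.2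
  choose m hm using fun p ↦ RingHom.mem_rangeS.mp (h p)
  refine ⟨d, nonZeroDivisors.ne_zero hd, Matrix.of fun i j ↦ m (i, j), ?_⟩
  ext i j
  have hij : (m (i, j) : ℚ) = d * B i j := by
    rw [← zsmul_eq_mul, ← hm (i, j)]
    rfl
  rw [Matrix.map_apply, Matrix.of_apply, hij, Matrix.smul_apply, zsmul_eq_mul]

/-- **Every rational endomorphism has an integral multiple in `End(X)`** (`End⁰(X) = End(X) ⊗ ℚ`).
[cite: Lange2023AbelianVarietiesComplex, §1.1.2 Prop. 1.1.8 and p. 22] -/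
theorem exists_zsmul_mem_endSubmodule (M : endAlgRat Φ) : ∃ n : ℤ, n ≠ 0 ∧ n • M ∈ endSubmodule Φ := by
  obtain ⟨d, hd, A, hA⟩ := exists_intMatrix_map_eq_zsmul (M : Matrix ι ι ℚ)
  have hAmem : A ∈ endRingInt Φ := by
    rw [mem_endRingInt_iff, hA]
    exact (endAlgRat Φ).toSubmodule.smul_of_tower_mem d M.2
  exact ⟨d, hd, (mem_endSubmodule_iff Φ).2 ⟨⟨A, hAmem⟩, by rw [hA]; rfl⟩⟩

/-- `End(X)` is a finitely generated `ℤ`-module (a subgroup of `M_ι(ℤ) ≅ ℤ^{ι×ι}`).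
[cite: Lange2023AbelianVarietiesComplex, §1.1.2 Prop. 1.1.8 ("`Hom(X, X′) ≅ ℤ^m`"), p. 22] -/
instance moduleFinite_endRingInt : Module.Finite ℤ (endRingInt Φ) := by
  haveI : IsNoetherian ℤ (Matrix ι ι ℤ) := isNoetherian_of_isNoetherianRing_of_finite ℤ _
  exact Module.Finite.of_injective (endRingInt Φ).subtype.toAddMonoidHom.toIntLinearMap
    (fun _ _ h ↦ Subtype.ext h)

/-- **`End(X)` is a full `ℤ`-lattice of `End⁰(X)`** (finitely generated, `ℚ · End(X) = End⁰(X)`).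
[cite: Lange2023AbelianVarietiesComplex, §1.1.2 Prop. 1.1.8 and p. 22] -/
theorem isFullLattice_endSubmodule : IsFullLattice (endAlgRat Φ) (endSubmodule Φ) := by
  refine ⟨?_, exists_zsmul_mem_endSubmodule Φ⟩
  rw [endSubmodule, LinearMap.range_eq_map]
  exact (Module.Finite.fg_top (R := ℤ) (M := endRingInt Φ)).map _

/-- **`End(X)` is a `ℤ`-order of `End⁰(X)`** (in the tree's sense `Brandt.IsOrder`, Voight Def. 10.2.1).
[cite: Kieffer2024IsogenyGraphs, §1.4.2 (orders in `End⁰(A)`), p. 46] [cite: Voight2021, Def. 10.2.1] -/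
theorem isOrder_endSubmodule : Brandt.IsOrder (endAlgRat Φ) (endSubmodule Φ) :=
  ⟨(mem_endSubmodule_iff Φ).2 ⟨1, by rw [OneMemClass.coe_one, Matrix.map_one Int.cast Int.cast_zero Int.cast_one]; rfl⟩,
    fun a ha b hb ↦ by
      obtain ⟨α, hα⟩ := (mem_endSubmodule_iff Φ).1 ha
      obtain ⟨β, hβ⟩ := (mem_endSubmodule_iff Φ).1 hb
      exact (mem_endSubmodule_iff Φ).2 ⟨α * β, by rw [Subring.coe_mul, map_intCast_mul_rat, hα, hβ]; rfl⟩,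
    isFullLattice_endSubmodule Φ⟩

/-- **"Since `S` is a lattice in `End⁰(A)`, there exists an integer `N ≥ 1` such that `NS ⊂ End(A)`"**: a full
`ℤ`-lattice `O ⊆ End⁰(X)` has `N·O ⊆ End(X)` for some `N ≠ 0` (the tree's `exists_smul_mem_of_fg`).
[cite: Kieffer2024IsogenyGraphs, §1.4.2 Prop. 1.4.8 (proof), p. 46] -/
theorem exists_smul_mem_endSubmodule {O : Submodule ℤ (endAlgRat Φ)} (hO : O.FG) :
    ∃ N : ℤ, N ≠ 0 ∧ ∀ s ∈ O, N • s ∈ endSubmodule Φ :=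
  exists_smul_mem_of_fg (isFullLattice_endSubmodule Φ) hO

variable (K : AddSubgroup (ComplexTorus Φ)) [Finite K]

/-- **`η : End(X/K) → End⁰(X)`** as a ring homomorphism into the `ℚ`-algebra `End⁰(X)` (`quotientEndHom` with
codomain restricted by `quotientEndHom_mem_endAlgRat`).
[cite: Kieffer2024IsogenyGraphs, §1.4.1 (the map `η : End(B) ↪ End⁰(A)`), p. 44] -/
def quotientEndToEndAlgRat : endRingInt (quotientByPeriod Φ K) →+* endAlgRat Φ :=
  (quotientEndHom Φ K).codRestrict (endAlgRat Φ) (quotientEndHom_mem_endAlgRat Φ K)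

/-- On matrices `quotientEndToEndAlgRat` is `η`. [cite: Kieffer2024IsogenyGraphs, §1.4.1 (the map `η`), p. 44] -/
@[simp] theorem coe_quotientEndToEndAlgRat (γ : endRingInt (quotientByPeriod Φ K)) :
    (quotientEndToEndAlgRat Φ K γ : Matrix ι ι ℚ) = quotientEndHom Φ K γ :=
  rfl

/-- **`η(End(X/K)) ⊆ End⁰(X)` as a `ℤ`-submodule.** [cite: Kieffer2024IsogenyGraphs, §1.4.1 (the map `η`) and §1.4.2 Prop. 1.4.8, pp. 44, 46] -/
def etaSubmodule : Submodule ℤ (endAlgRat Φ) :=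
  LinearMap.range (quotientEndToEndAlgRat Φ K).toAddMonoidHom.toIntLinearMap

/-- Membership in `η(End(X/K))`. [cite: Kieffer2024IsogenyGraphs, §1.4.1 (the map `η`), p. 44] -/
theorem mem_etaSubmodule_iff {M : endAlgRat Φ} :
    M ∈ etaSubmodule Φ K ↔ (M : Matrix ι ι ℚ) ∈ (quotientEndHom Φ K).range := by
  constructor
  · rintro ⟨γ, hγ⟩
    exact ⟨γ, by rw [← hγ]; rfl⟩
  · rintro ⟨γ, hγ⟩
    exact ⟨γ, Subtype.ext hγ⟩

/-- **`det Q_K · η(γ) ∈ End(X)`** for `γ ∈ End(X/K)`: `det Q · Q⁻¹ γ Q = adj(Q) γ Q` is an integer matrix in `End⁰(X)`.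
[cite: Kieffer2024IsogenyGraphs, §1.1.5 Prop. 1.1.25 (`η(α) = (1/n) ψ ∘ α ∘ φ` with `ψ ∘ α ∘ φ ∈ Hom`), p. 17] -/
theorem exists_coe_eq_det_smul_quotientEndHom (γ : endRingInt (quotientByPeriod Φ K)) :
    ∃ α : endRingInt Φ, (α : Matrix ι ι ℤ).map (Int.cast : ℤ → ℚ) =
      ((quotientMatrix Φ K).det : ℚ) • quotientEndHom Φ K γ := by
  have huq : IsUnit (quotientMatrixRat Φ K).det := isUnit_det_quotientMatrixRat Φ K
  have hdet : ((quotientMatrix Φ K).det : ℚ) = (quotientMatrixRat Φ K).det := Int.cast_det _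
  have heq : ((quotientMatrix Φ K).adjugate * (γ : Matrix ι ι ℤ) * quotientMatrix Φ K).map (Int.cast : ℤ → ℚ) =
      ((quotientMatrix Φ K).det : ℚ) • quotientEndHom Φ K γ := by
    rw [map_intCast_mul_rat, map_intCast_mul_rat, ← adjugate_map_intCast, quotientEndHom_apply, hdet,
      ← det_smul_nonsing_inv huq, Matrix.smul_mul, Matrix.smul_mul]
  refine ⟨⟨_, (mem_endRingInt_iff Φ).2 ?_⟩, heq⟩
  rw [heq]
  exact (endAlgRat Φ).smul_mem (quotientEndHom_mem_endAlgRat Φ K γ) _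

/-- **`det Q_K · α ∈ η(End(X/K))`** for `α ∈ End(X)`: `det Q · α = η(Q α adj(Q))`, and `Q α adj(Q) = det Q · (Q α Q⁻¹)`
lies in `End(X/K)` (conjugation by `Q` is `End⁰(X) ≅ End⁰(X/K)`).
[cite: Kieffer2024IsogenyGraphs, §1.1.5 Prop. 1.1.25 ("its inverse is `β ↦ (1/n) φ ∘ β ∘ ψ`"), p. 17] -/
theorem det_smul_coe_mem_range_quotientEndHom (α : endRingInt Φ) :
    ((quotientMatrix Φ K).det : ℚ) • (α : Matrix ι ι ℤ).map (Int.cast : ℤ → ℚ) ∈ (quotientEndHom Φ K).range := by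
  have huq : IsUnit (quotientMatrixRat Φ K).det := isUnit_det_quotientMatrixRat Φ K
  have hdet : ((quotientMatrix Φ K).det : ℚ) = (quotientMatrixRat Φ K).det := Int.cast_det _
  -- `γ = Q α adj(Q)`, with `γ_ℚ = det Q · (Q α_ℚ Q⁻¹) ∈ End⁰(X/K)`
  have hγq : (quotientMatrix Φ K * (α : Matrix ι ι ℤ) * (quotientMatrix Φ K).adjugate).map (Int.cast : ℤ → ℚ) =
      ((quotientMatrix Φ K).det : ℚ) • (quotientMatrixRat Φ K * (α : Matrix ι ι ℤ).map (Int.cast : ℤ → ℚ) *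
        (quotientMatrixRat Φ K)⁻¹) := by
    rw [map_intCast_mul_rat, map_intCast_mul_rat, ← adjugate_map_intCast, hdet, ← det_smul_nonsing_inv huq,
      Matrix.mul_smul]
  have hγmem : quotientMatrix Φ K * (α : Matrix ι ι ℤ) * (quotientMatrix Φ K).adjugate ∈
      endRingInt (quotientByPeriod Φ K) := by
    rw [mem_endRingInt_iff, hγq]
    refine (endAlgRat (quotientByPeriod Φ K)).smul_mem ?_ _
    exact ((quotientEndAlgEquiv Φ K).symm ⟨_, (mem_endRingInt_iff Φ).1 α.2⟩).2
  refine ⟨⟨_, hγmem⟩, ?_⟩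
  rw [quotientEndHom_apply]
  change (quotientMatrixRat Φ K)⁻¹ *
      (quotientMatrix Φ K * (α : Matrix ι ι ℤ) * (quotientMatrix Φ K).adjugate).map (Int.cast : ℤ → ℚ) *
      quotientMatrixRat Φ K = _
  rw [hγq, Matrix.mul_smul, Matrix.smul_mul,
    show (quotientMatrixRat Φ K)⁻¹ * (quotientMatrixRat Φ K * (α : Matrix ι ι ℤ).map (Int.cast : ℤ → ℚ) *
      (quotientMatrixRat Φ K)⁻¹) * quotientMatrixRat Φ K = (quotientMatrixRat Φ K)⁻¹ * (quotientMatrixRat Φ K *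
      ((α : Matrix ι ι ℤ).map (Int.cast : ℤ → ℚ) * ((quotientMatrixRat Φ K)⁻¹ * quotientMatrixRat Φ K))) by
      simp only [Matrix.mul_assoc],
    Matrix.nonsing_inv_mul _ huq, Matrix.mul_one, Matrix.nonsing_inv_mul_cancel_left _ _ huq]

/-- **`η(End(X/K))` is a full `ℤ`-lattice of `End⁰(X)`**: finitely generated (`End(X/K)` is), and
`(det Q_K · n) · M ∈ η(End(X/K))` whenever `n · M ∈ End(X)`.
[cite: Kieffer2024IsogenyGraphs, §1.1.5 Prop. 1.1.25 (p. 17) and §1.4.2 Prop. 1.4.8 (p. 46)] -/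
theorem isFullLattice_etaSubmodule : IsFullLattice (endAlgRat Φ) (etaSubmodule Φ K) := by
  refine ⟨?_, fun M ↦ ?_⟩
  · rw [etaSubmodule, LinearMap.range_eq_map]
    exact (Module.Finite.fg_top (R := ℤ) (M := endRingInt (quotientByPeriod Φ K))).map _
  · obtain ⟨n, hn, hnM⟩ := exists_zsmul_mem_endSubmodule Φ M
    obtain ⟨α, hα⟩ := (mem_endSubmodule_iff Φ).1 hnM
    refine ⟨(quotientMatrix Φ K).det * n, mul_ne_zero (det_quotientMatrix_ne_zero Φ K) hn, ?_⟩
    rw [coe_zsmul_endAlgRat] at hα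
    rw [mem_etaSubmodule_iff, mul_smul, coe_zsmul_endAlgRat, coe_zsmul_endAlgRat, ← hα]
    exact det_smul_coe_mem_range_quotientEndHom Φ K α

/-- **`η(End(X/K))` is a `ℤ`-order of `End⁰(X)`** for every finite `K ≤ X`.
[cite: Kieffer2024IsogenyGraphs, §1.1.5 Prop. 1.1.25 (p. 17) and §1.4.2 Prop. 1.4.8 (p. 46)] [cite: Voight2021, Def. 10.2.1] -/
theorem isOrder_etaSubmodule : Brandt.IsOrder (endAlgRat Φ) (etaSubmodule Φ K) :=
  ⟨(mem_etaSubmodule_iff Φ K).2 ⟨1, by rw [map_one]; rfl⟩,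
    fun a ha b hb ↦ by
      obtain ⟨γ, hγ⟩ := (mem_etaSubmodule_iff Φ K).1 ha
      obtain ⟨δ, hδ⟩ := (mem_etaSubmodule_iff Φ K).1 hb
      exact (mem_etaSubmodule_iff Φ K).2 ⟨γ * δ, by rw [map_mul, hγ, hδ]; rfl⟩,
    isFullLattice_etaSubmodule Φ K⟩

/-- `End(X/K) ≅ η(End(X/K))` as rings (`η` is injective). [cite: Kieffer2024IsogenyGraphs, §1.4.1 ("`η : End(B) ↪ End⁰(A)`"), p. 44] -/
def quotientEndEquivRange : endRingInt (quotientByPeriod Φ K) ≃+* (quotientEndHom Φ K).range :=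
  RingEquiv.ofBijective (quotientEndHom Φ K).rangeRestrict
    ⟨fun _ _ h ↦ quotientEndHom_injective Φ K (congrArg Subtype.val h), RingHom.rangeRestrict_surjective _⟩

/-- `quotientEndEquivRange` is `η` on matrices. [cite: Kieffer2024IsogenyGraphs, §1.4.1 (the map `η`), p. 44] -/
@[simp] theorem coe_quotientEndEquivRange (γ : endRingInt (quotientByPeriod Φ K)) :
    (quotientEndEquivRange Φ K γ : Matrix ι ι ℚ) = quotientEndHom Φ K γ :=
  rfl

end Orders

/-! ## §3 Prop. 1.4.8: a maximal order `S` is `η(End(X/H(End(X)·NS)))` -/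

section Prop148

open Literature.NumberTheory.Automorphic

variable (O : Submodule ℤ (endAlgRat Φ)) (N : ℤ)

/-- **`I = End(X)·NS`**, the left ideal of `End(X)` generated by `NS ⊆ End(X)` (for an order `S` and `N` with
`N·S ⊆ End(X)`). [cite: Kieffer2024IsogenyGraphs, §1.4.2 Prop. 1.4.8 (proof: "Let `I = End(A)NS` be the ideal generated by `NS`"), p. 46] -/
def idealOfOrder : Ideal (endRingInt Φ) :=
  Ideal.span {α | ∃ s ∈ O, (α : Matrix ι ι ℤ).map (Int.cast : ℤ → ℚ) = (N : ℚ) • (s : Matrix ι ι ℚ)}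

variable {O N}

/-- The generators `Ns` (`s ∈ S`) lie in `I`. [cite: Kieffer2024IsogenyGraphs, §1.4.2 Prop. 1.4.8 (proof), p. 46] -/
theorem mem_idealOfOrder_of_coe_eq {α : endRingInt Φ} {s : endAlgRat Φ} (hs : s ∈ O)
    (h : (α : Matrix ι ι ℤ).map (Int.cast : ℤ → ℚ) = (N : ℚ) • (s : Matrix ι ι ℚ)) : α ∈ idealOfOrder Φ O N :=
  Ideal.subset_span ⟨s, hs, h⟩

/-- `N·s ∈ End(X)` (in `endSubmodule`) means `α_ℚ = N s` for an integral `α`. [cite: Kieffer2024IsogenyGraphs, §1.4.2 Prop. 1.4.8 (proof), p. 46] -/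
theorem exists_coe_eq_smul_of_smul_mem {s : endAlgRat Φ} (h : N • s ∈ endSubmodule Φ) :
    ∃ α : endRingInt Φ, (α : Matrix ι ι ℤ).map (Int.cast : ℤ → ℚ) = (N : ℚ) • (s : Matrix ι ι ℚ) := by
  obtain ⟨α, hα⟩ := (mem_endSubmodule_iff Φ).1 h
  exact ⟨α, by rw [hα, coe_zsmul_endAlgRat]⟩

/-- **`N = N·1 ∈ I` is an isogeny**: `I` contains an element of non-zero determinant (`N ≠ 0`, `1 ∈ S`).
[cite: Kieffer2024IsogenyGraphs, §1.4.2 Prop. 1.4.8 (proof) and §1.4.1 ("`I` contains an isogeny"), pp. 43, 46] -/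
theorem exists_mem_idealOfOrder_det_ne_zero (h1 : (1 : endAlgRat Φ) ∈ O) (hN0 : N ≠ 0)
    (hN : ∀ s ∈ O, N • s ∈ endSubmodule Φ) :
    ∃ α ∈ idealOfOrder Φ O N, (α : Matrix ι ι ℤ).det ≠ 0 := by
  obtain ⟨α, hα⟩ := exists_coe_eq_smul_of_smul_mem Φ (hN 1 h1)
  refine ⟨α, mem_idealOfOrder_of_coe_eq Φ h1 hα, fun h0 ↦ ?_⟩
  have h : ((α : Matrix ι ι ℤ).det : ℚ) = (N : ℚ) ^ Fintype.card ι := by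
    rw [Int.cast_det, hα, OneMemClass.coe_one, Matrix.det_smul, Matrix.det_one, mul_one]
  rw [h0, Int.cast_zero] at h
  exact pow_ne_zero _ (Int.cast_ne_zero.2 hN0) h.symm

/-- `H(I)` is finite (`I` contains the isogeny `N`). [cite: Kieffer2024IsogenyGraphs, §1.4.2 Prop. 1.4.8 (proof), p. 46] -/
theorem finite_kernelSubgroup_idealOfOrder (h1 : (1 : endAlgRat Φ) ∈ O) (hN0 : N ≠ 0)
    (hN : ∀ s ∈ O, N • s ∈ endSubmodule Φ) : Finite (kernelSubgroup Φ (idealOfOrder Φ O N)) := by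
  obtain ⟨α, hα, hdet⟩ := exists_mem_idealOfOrder_det_ne_zero Φ h1 hN0 hN
  exact finite_kernelSubgroup_of_mem Φ hα hdet

/-- **"Then the right order of `I` contains `S`"**: for `s ∈ S` (an order) and `σ ∈ I = End(X)·NS`, `σ s ∈ I` — on
generators `(N s′) s = N (s′ s)` with `s′s ∈ S`, and `σ ↦ σ s` is additive and `End(X)`-linear.
[cite: Kieffer2024IsogenyGraphs, §1.4.2 Prop. 1.4.8 (proof), p. 46] -/
theorem mem_rightOrder_idealOfOrder (hmul : ∀ a ∈ O, ∀ b ∈ O, a * b ∈ O)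
    (hN : ∀ s ∈ O, N • s ∈ endSubmodule Φ) {s : endAlgRat Φ} (hs : s ∈ O) :
    (s : Matrix ι ι ℚ) ∈ rightOrder Φ (idealOfOrder Φ O N) := by
  refine ⟨s.2, fun σ hσ ↦ ?_⟩
  induction hσ using Submodule.span_induction with
  | mem α hα =>
    obtain ⟨s', hs', hα'⟩ := hα
    obtain ⟨τ, hτ⟩ := exists_coe_eq_smul_of_smul_mem Φ (hN (s' * s) (hmul s' hs' s hs))
    exact ⟨τ, mem_idealOfOrder_of_coe_eq Φ (hmul s' hs' s hs) hτ, by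
      rw [hτ, hα', Matrix.smul_mul, Subalgebra.coe_mul]⟩
  | zero => exact ⟨0, Submodule.zero_mem _, by
      rw [ZeroMemClass.coe_zero, Matrix.map_zero Int.cast Int.cast_zero, Matrix.zero_mul]⟩
  | add σ₁ σ₂ _ _ h₁ h₂ =>
    obtain ⟨τ₁, hτ₁, hτ₁e⟩ := h₁
    obtain ⟨τ₂, hτ₂, hτ₂e⟩ := h₂
    exact ⟨τ₁ + τ₂, Submodule.add_mem _ hτ₁ hτ₂, by
      rw [Subring.coe_add, Subring.coe_add, Matrix.map_add Int.cast Int.cast_add,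
        Matrix.map_add Int.cast Int.cast_add, hτ₁e, hτ₂e, Matrix.add_mul]⟩
  | smul β σ _ h =>
    obtain ⟨τ, hτ, hτe⟩ := h
    exact ⟨β * τ, Ideal.mul_mem_left _ β hτ, by
      rw [smul_eq_mul, Subring.coe_mul, Subring.coe_mul, map_intCast_mul_rat, map_intCast_mul_rat, hτe,
        Matrix.mul_assoc]⟩

/-- `S ⊆ η(End(X/H(I)))`: `S ⊆ O_r(I) ⊆ η(End(X/H(I)))` (`rightOrder_le_range_quotientEndHom`, valid for every `I`
with `H(I)` finite — Prop. 1.4.7's kernel-ideal hypothesis is not needed for this inclusion).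
[cite: Kieffer2024IsogenyGraphs, §1.4.2 Prop. 1.4.8 (proof) and §1.4.1 Prop. 1.4.7 (proof), p. 46] -/
theorem le_etaSubmodule_idealOfOrder (hmul : ∀ a ∈ O, ∀ b ∈ O, a * b ∈ O)
    (hN : ∀ s ∈ O, N • s ∈ endSubmodule Φ) [Finite (kernelSubgroup Φ (idealOfOrder Φ O N))] :
    O ≤ etaSubmodule Φ (kernelSubgroup Φ (idealOfOrder Φ O N)) := fun _ hs ↦
  (mem_etaSubmodule_iff Φ _).2
    (rightOrder_le_range_quotientEndHom Φ _ (mem_rightOrder_idealOfOrder Φ hmul hN hs))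

/-- **`η(End(X/H(I))) = S` for a maximal order `S` and `I = End(X)·NS`**: `S ⊆ η(End(X/H(I)))`, the latter is an
order, and `S` is maximal. [cite: Kieffer2024IsogenyGraphs, §1.4.2 Prop. 1.4.8 (proof: "The endomorphism ring of `A/H(I)` is `S`"), p. 46] -/
theorem etaSubmodule_eq_of_isMaximalOrder (hO : Brandt.IsMaximalOrder (endAlgRat Φ) O)
    (hN : ∀ s ∈ O, N • s ∈ endSubmodule Φ) [Finite (kernelSubgroup Φ (idealOfOrder Φ O N))] :
    etaSubmodule Φ (kernelSubgroup Φ (idealOfOrder Φ O N)) = O :=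
  hO.2 _ (isOrder_etaSubmodule Φ _) (le_etaSubmodule_idealOfOrder Φ hO.1.mul_mem hN)

/-- The same on matrices: `η(γ)` runs exactly through (the matrices of) `S`.
[cite: Kieffer2024IsogenyGraphs, §1.4.2 Prop. 1.4.8, p. 46] -/
theorem mem_range_quotientEndHom_iff_of_isMaximalOrder (hO : Brandt.IsMaximalOrder (endAlgRat Φ) O)
    (hN : ∀ s ∈ O, N • s ∈ endSubmodule Φ) [Finite (kernelSubgroup Φ (idealOfOrder Φ O N))]
    {M : Matrix ι ι ℚ} :
    M ∈ (quotientEndHom Φ (kernelSubgroup Φ (idealOfOrder Φ O N))).range ↔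
      ∃ s ∈ O, (s : Matrix ι ι ℚ) = M := by
  constructor
  · rintro ⟨γ, rfl⟩
    exact ⟨quotientEndToEndAlgRat Φ _ γ, (etaSubmodule_eq_of_isMaximalOrder Φ hO hN).le ⟨γ, rfl⟩, rfl⟩
  · rintro ⟨s, hs, rfl⟩
    exact (mem_etaSubmodule_iff Φ _).1 ((etaSubmodule_eq_of_isMaximalOrder Φ hO hN).ge hs)

/-- **"the right order of `I` contains `S`, so equals it"**: `O_r(End(X)·NS) = S` (as sets of matrices) for a maximal
order `S`. [cite: Kieffer2024IsogenyGraphs, §1.4.2 Prop. 1.4.8 (proof), p. 46] -/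
theorem mem_rightOrder_idealOfOrder_iff_of_isMaximalOrder (hO : Brandt.IsMaximalOrder (endAlgRat Φ) O)
    (hN : ∀ s ∈ O, N • s ∈ endSubmodule Φ) [Finite (kernelSubgroup Φ (idealOfOrder Φ O N))]
    {M : Matrix ι ι ℚ} :
    M ∈ rightOrder Φ (idealOfOrder Φ O N) ↔ ∃ s ∈ O, (s : Matrix ι ι ℚ) = M :=
  ⟨fun h ↦ (mem_range_quotientEndHom_iff_of_isMaximalOrder Φ hO hN).1 (rightOrder_le_range_quotientEndHom Φ _ h),
    fun ⟨_, hs, hsM⟩ ↦ hsM ▸ mem_rightOrder_idealOfOrder Φ hO.1.mul_mem hN hs⟩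

/-- **PROPOSITION 1.4.8. "Let `S` be any maximal order in `End⁰(A)`. Then there exists another abelian variety `B` in
the isogeny class of `A` whose endomorphism ring is isomorphic to `S`."** At torus level: for every complex torus
`X` and every maximal `ℤ`-order `S` of `End⁰(X)` (the tree's `Brandt.IsMaximalOrder`) there is a finite subgroup
`K ≤ X` (namely `K = H(End(X)·NS)`) such that the quotient torus `X/K` — isogenous to `X` — has
`η(End(X/K)) = S`: its endomorphism ring `End(X/K) ≅ η(End(X/K))` (`quotientEndEquivRange`) is `S`.
[cite: Kieffer2024IsogenyGraphs, §1.4.2 Prop. 1.4.8, p. 46] -/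
theorem exists_quotient_etaSubmodule_eq_of_isMaximalOrder (hO : Brandt.IsMaximalOrder (endAlgRat Φ) O) :
    ∃ (K : AddSubgroup (ComplexTorus Φ)) (_ : Finite K),
      IsIsogenous Φ (quotientByPeriod Φ K) ∧ etaSubmodule Φ K = O ∧
        ∀ M : Matrix ι ι ℚ, M ∈ (quotientEndHom Φ K).range ↔ ∃ s ∈ O, (s : Matrix ι ι ℚ) = M := by
  obtain ⟨N, hN0, hN⟩ := exists_smul_mem_endSubmodule Φ hO.1.isFullLattice.1
  haveI := finite_kernelSubgroup_idealOfOrder Φ hO.1.one_mem hN0 hN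
  exact ⟨kernelSubgroup Φ (idealOfOrder Φ O N), this, isIsogenous_quotientPeriod Φ _ _,
    etaSubmodule_eq_of_isMaximalOrder Φ hO hN, fun _ ↦ mem_range_quotientEndHom_iff_of_isMaximalOrder Φ hO hN⟩

end Prop148

end ComplexTorus

end Literature.Geometry.Kaehler
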